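/-
Copyright: width seat `ym-line-sgb-p1-w2` (prover-ym-line-sgb-p1-w2-g0-0), route `SteinGapBootstrap` (rev 2), crux K2
`GapGivesClusteringG` (stmt-QuantumFields-22999), line `birth` (BC3 skeleton `GapGivesClusteringG_birth_pub.lean`, planner ym-idea-4).
-/
import Summits.QuantumFields.YangMills.Theorems.WeakCouplingRatesCalibrationRP
import Literature.MathematicalPhysics.QuantumFieldTheory.SpeciesTimeReflection
import HarnessLib

/-!
# Crux `GapGivesClusteringG` (route `SteinGapBootstrap`, K2), registered stub `stub_pairFormSymm`: time-reflection invariance of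
# EVERY torus-limit state and the symmetry / shift rules of the two-observable reflection form

NOT THE CLAY GAP (the route closes the RECORD-label rung leaf `WeakCouplingRates.XiPow`, an UPPER bound on lattice gaps).

The crux asks for the off-diagonal clustering `|⟨θA · α_t B⟩_μ − ⟨θA⟩_μ⟨α_t B⟩_μ| ≤ 2 e^{−mt} a b` of a torus-limit state `μ` with an
RP-spectral gap `HasRPTimeGap μ m`.  The BC3 line «polarisation» isolates three lemmas; this file lands the second one,
`stub_pairFormSymm` — the symmetry `B_t(A, B) = B_t(B, A)` of the pair form
`B_t(A, B) := ⟨(A∘θ)·(B∘α_t)⟩_μ − ⟨A∘θ⟩_μ ⟨B∘α_t⟩_μ` — BY NAME AND SIGNATURE, together with the two facts about limit states it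
rests on, which the other stubs also consume:

* §1 geometry of the site reflection `θ = timeReflectLG` of `ℤ⁴` gauge fields: it IS the tree's `cfgReflect` (`SpeciesTimeReflection` /
  `QCDTimeReflection`), hence an involution, and the periodic lift intertwines it with the torus site reflection
  `GaugeConfig.negReflect` on EVERY torus side (`timeReflectLG_torusLift`);
* §2 **θ-invariance of every torus-limit state** (`integral_comp_timeReflectLG_of_mem_limitPoints`): `∫ F(θU) dμ = ∫ F dμ` for every
  bounded continuous cylinder observable, every real `β`, every model `ρ`, and every `μ ∈ infiniteVolumeLimitPoints ρ β` — limits along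
  tori of ANY parity — from the all-sides torus invariance `integral_comp_negReflect_eq` exactly as the tree's B-TI
  `integral_comp_configShift_of_mem_limitPoints` passes translation invariance to the limit;
* §3 the pair form: symmetry (`pairForm_symm`, θ-invariance + B-TI + `α_t ∘ θ = θ ∘ T_{t e₀}`) and the shift rule
  `B_{n+s}(A, B) = B_n^{(θ)}(α_s A, B)`, i.e. `⟨θA·α_{n+s}B⟩ − ⟨θA⟩⟨α_{n+s}B⟩ = ⟨θ(α_sA)·α_nB⟩ − ⟨θ(α_sA)⟩⟨α_nB⟩` (`pairForm_shift`, B-TI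
  only) — the rule that turns the diagonal gap bound at time `2s` into a bound on the time-`0` form of `α_s F`, used by the
  Cauchy–Schwarz step of the line;
* §4 `stub_pairFormSymm` with the registered signature (the hypothesis `IsCompactSimpleLieGroup G` is not used: the symmetry holds for
  every compact `G` and continuous `ρ`).

References: K. Osterwalder, E. Seiler, Ann. Phys. 110 (1978) 440, §2; E. Seiler, LNP 159 (1982) Ch. 2–3. All statements here are
proved; no statement about the mass gap is made.
-/

set_option autoImplicit false

noncomputable section

open MeasureTheory Filter Topology
open Literature.MathematicalPhysics Literature.MathematicalPhysics.QuantumFieldTheory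
  Literature.MathematicalPhysics.QuantumLattice
open Summit.QuantumFields.YangMills.Theorems.WeakCouplingRates

namespace Summit.QuantumFields.YangMills.Theorems.SteinGapBootstrap

/-! ### §1. The site reflection `θ` of `ℤ⁴` gauge fields: `cfgReflect = timeReflectLG`, involution, periodic lift -/

section Geometry

variable {G : Type} [Group G]

/-- P3's site reflection `timeReflectLG` (currency of `HasRPTimeGap`) is the tree's `cfgReflect` (`QCDTimeReflection`): spatial links
read at the reflected site, temporal links reversed and inverted. [cite: OsterwalderSeiler1978, §2] -/
theorem cfgReflect_eq_timeReflectLG (U : LGConfig 4 G) : cfgReflect U = timeReflectLG U := by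
  funext e
  rcases e with ⟨x, i⟩
  by_cases hi : i = 0
  · subst hi
    simp [cfgReflect, reflectEdge, timeReflectLG, trSite, siteReflect]
  · simp [cfgReflect, reflectEdge, timeReflectLG, trSite, siteReflect, hi]

/-- `θ ∘ θ = id` on `ℤ⁴` gauge fields. [cite: OsterwalderSeiler1978, §2] -/
@[simp] theorem timeReflectLG_timeReflectLG (U : LGConfig 4 G) : timeReflectLG (timeReflectLG U) = U := by
  rw [← cfgReflect_eq_timeReflectLG, ← cfgReflect_eq_timeReflectLG, cfgReflect_cfgReflect]

/-- **The periodic lift intertwines the site reflections on EVERY torus side** `L`: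
`θ (torusLift L V) = torusLift L (Θ' V)`, `Θ' = GaugeConfig.negReflect`. [cite: OsterwalderSeiler1978, §2] -/
theorem timeReflectLG_torusLift (L : ℕ) (V : GaugeConfig 4 L G) :
    timeReflectLG (torusLift L V) = torusLift L V.negReflect := by
  rw [torusLift_negReflect, cfgReflect_eq_timeReflectLG]

/-- The torus observable of `F ∘ θ` is the torus observable of `F` read on the `Θ'`-reflected torus field. [cite: OsterwalderSeiler1978, §2] -/
theorem toTorusObservable_comp_timeReflectLG {α : Type*} (L : ℕ) (F : LGConfig 4 G → α) :
    toTorusObservable L (fun U => F (timeReflectLG U)) = fun V => toTorusObservable L F V.negReflect := by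
  funext V
  simp only [toTorusObservable_apply, timeReflectLG_torusLift]

omit [Group G] in
/-- `α_t ∘ T_{t e₀} = id`: the time shift `α_t` undoes the translation by `+t e₀`. [folklore] -/
theorem timeShiftLG_configShift_single [MeasurableSpace G] (t : ℕ) (U : LGConfig 4 G) :
    timeShiftLG (G := G) t (configShift (Pi.single 0 (t : ℤ)) U) = U := by
  have h := timeShiftLG_add_configShift_single (G := G) (d := 4) 0 t U
  rw [zero_add, timeShiftLG_zero] at h
  exact h

end Geometry

/-! ### §2. Time-reflection invariance of every torus-limit state -/

section Invariance

variable {N : ℕ} {G : Type} [Group G] [TopologicalSpace G] [IsTopologicalGroup G] [CompactSpace G]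
  [MeasurableSpace G] [BorelSpace G] (ρ : G →* Matrix (Fin N) (Fin N) ℂ)

/-- **θ-invariance of torus-limit states.** For a continuous model `ρ`, every real `β` and every infinite-volume limit point `μ` of the
torus Wilson states (limits along tori `Λ_{L_k+1}` of ANY parity), `∫ F(θU) dμ = ∫ F dμ` for every bounded continuous cylinder
observable `F`: each torus state is invariant under its site reflection `Θ'` (`integral_comp_negReflect_eq`, every side), and the
periodic lift carries `θ` to `Θ'` (`timeReflectLG_torusLift`). [cite: OsterwalderSeiler1978, §2] -/
theorem integral_comp_timeReflectLG_of_mem_limitPoints (hρ : Continuous ρ) {β : ℝ} {μ : Measure (LGConfig 4 G)}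
    (hμ : μ ∈ infiniteVolumeLimitPoints (d := 4) ρ β) {F : LGConfig 4 G → ℝ} {S : Finset (QuantumLattice.ZdEdge 4)}
    (hFS : IsCylinder F S) (hFc : Continuous F) (hFb : ∃ C, ∀ U, |F U| ≤ C) :
    ∫ U, F (timeReflectLG U) ∂μ = ∫ U, F U ∂μ := by
  obtain ⟨L, _hL, _hprob, hconv⟩ := hμ
  obtain ⟨S', hS'⟩ := exists_isCylinder_comp_timeReflectLG (G := G) hFS
  have h1 := hconv (fun U => F (timeReflectLG U)) S' hS' (hFc.comp continuous_timeReflectLG)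
    (by obtain ⟨C, hC⟩ := hFb; exact ⟨C, fun U => hC _⟩)
  have h2 := hconv F S hFS hFc hFb
  have hE : (fun k : ℕ => wilsonExpectation (L := L k + 1) ρ β
      (toTorusObservable (L k + 1) (fun U => F (timeReflectLG U)))) =
      fun k : ℕ => wilsonExpectation (L := L k + 1) ρ β (toTorusObservable (L k + 1) F) := by
    funext k
    rw [toTorusObservable_comp_timeReflectLG]
    exact integral_comp_negReflect_eq ρ hρ β (toTorusObservable (L k + 1) F)
  rw [hE] at h1
  exact tendsto_nhds_unique h1 h2

/-- Time-shift invariance of torus-limit states in P3's currency: `∫ F(α_t U) dμ = ∫ F dμ` (the tree's B-TI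
`integral_comp_configShift_of_mem_limitPoints` at `v = -t e₀`). [folklore] -/
theorem integral_comp_timeShiftLG_of_mem_limitPoints {β : ℝ} {μ : Measure (LGConfig 4 G)}
    (hμ : μ ∈ infiniteVolumeLimitPoints (d := 4) ρ β) {F : LGConfig 4 G → ℝ} {S : Finset (QuantumLattice.ZdEdge 4)}
    (hFS : IsCylinder F S) (hFc : Continuous F) (hFb : ∃ C, ∀ U, |F U| ≤ C) (t : ℕ) :
    ∫ U, F (timeShiftLG (G := G) t U) ∂μ = ∫ U, F U ∂μ :=
  integral_comp_configShift_of_mem_limitPoints ρ hμ _ hFS hFc hFb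

end Invariance

/-! ### §3. The two-observable reflection form: bookkeeping, symmetry, shift rule -/

section PairForm

variable {G : Type} [Group G] [TopologicalSpace G] [IsTopologicalGroup G] [CompactSpace G]
  [MeasurableSpace G] [BorelSpace G]

omit [IsTopologicalGroup G] [CompactSpace G] [BorelSpace G] in
/-- Bookkeeping: `U ↦ F(α_t(θU))` is a bounded continuous cylinder observable if `F` is. [folklore] -/
theorem obs_comp_timeShiftLG_timeReflectLG [ContinuousInv G] {F : LGConfig 4 G → ℝ} {S : Finset (QuantumLattice.ZdEdge 4)}
    (hFS : IsCylinder F S) (hFc : Continuous F) (hFb : ∃ C, ∀ U, |F U| ≤ C) (t : ℕ) :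
    (∃ S', IsCylinder (fun U => F (timeShiftLG (G := G) t (timeReflectLG U))) S') ∧
      Continuous (fun U => F (timeShiftLG (G := G) t (timeReflectLG U))) ∧
      ∃ C, ∀ U, |F (timeShiftLG (G := G) t (timeReflectLG U))| ≤ C := by
  refine ⟨?_, hFc.comp ((continuous_timeShiftLG t).comp continuous_timeReflectLG), ?_⟩
  · exact exists_isCylinder_comp_timeReflectLG (G := G) (F := fun U => F (timeShiftLG (G := G) t U))
      (isCylinder_timeShift hFS t)
  · obtain ⟨C, hC⟩ := hFb
    exact ⟨C, fun U => hC _⟩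

omit [IsTopologicalGroup G] [CompactSpace G] [BorelSpace G] in
/-- Bookkeeping: `U ↦ F(θ(α_t U))` is a bounded continuous cylinder observable if `F` is. [folklore] -/
theorem obs_comp_timeReflectLG_timeShiftLG [ContinuousInv G] {F : LGConfig 4 G → ℝ} {S : Finset (QuantumLattice.ZdEdge 4)}
    (hFS : IsCylinder F S) (hFc : Continuous F) (hFb : ∃ C, ∀ U, |F U| ≤ C) (t : ℕ) :
    (∃ S', IsCylinder (fun U => F (timeReflectLG (timeShiftLG (G := G) t U))) S') ∧
      Continuous (fun U => F (timeReflectLG (timeShiftLG (G := G) t U))) ∧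
      ∃ C, ∀ U, |F (timeReflectLG (timeShiftLG (G := G) t U))| ≤ C := by
  obtain ⟨S₁, hS₁⟩ := exists_isCylinder_comp_timeReflectLG (G := G) hFS
  refine ⟨⟨_, isCylinder_timeShift hS₁ t⟩, (hFc.comp continuous_timeReflectLG).comp (continuous_timeShiftLG t), ?_⟩
  obtain ⟨C, hC⟩ := hFb
  exact ⟨C, fun U => hC _⟩

omit [IsTopologicalGroup G] [CompactSpace G] [BorelSpace G] in
/-- Bookkeeping: `F ∘ θ` is a bounded continuous cylinder observable if `F` is. [folklore] -/
theorem obs_comp_timeReflectLG [ContinuousInv G] {F : LGConfig 4 G → ℝ} {S : Finset (QuantumLattice.ZdEdge 4)}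
    (hFS : IsCylinder F S) (hFc : Continuous F) (hFb : ∃ C, ∀ U, |F U| ≤ C) :
    (∃ S', IsCylinder (fun U => F (timeReflectLG U)) S') ∧
      Continuous (fun U => F (timeReflectLG U)) ∧ ∃ C, ∀ U, |F (timeReflectLG U)| ≤ C := by
  refine ⟨exists_isCylinder_comp_timeReflectLG (G := G) hFS, hFc.comp continuous_timeReflectLG, ?_⟩
  obtain ⟨C, hC⟩ := hFb
  exact ⟨C, fun U => hC _⟩

omit [Group G] [TopologicalSpace G] [IsTopologicalGroup G] [CompactSpace G] [MeasurableSpace G] [BorelSpace G] in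
/-- Bookkeeping: `F ∘ α_t` is a bounded continuous cylinder observable if `F` is. [folklore] -/
theorem obs_comp_timeShiftLG [TopologicalSpace G] [MeasurableSpace G] {F : LGConfig 4 G → ℝ}
    {S : Finset (QuantumLattice.ZdEdge 4)}
    (hFS : IsCylinder F S) (hFc : Continuous F) (hFb : ∃ C, ∀ U, |F U| ≤ C) (t : ℕ) :
    IsCylinder (fun U => F (timeShiftLG (G := G) t U)) (S.image fun e => (e.1 + Pi.single 0 (t : ℤ), e.2)) ∧
      Continuous (fun U => F (timeShiftLG (G := G) t U)) ∧ ∃ C, ∀ U, |F (timeShiftLG (G := G) t U)| ≤ C := by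
  refine ⟨isCylinder_timeShift hFS t, hFc.comp (continuous_timeShiftLG t), ?_⟩
  obtain ⟨C, hC⟩ := hFb
  exact ⟨C, fun U => hC _⟩

omit [Group G] [TopologicalSpace G] [IsTopologicalGroup G] [CompactSpace G] [MeasurableSpace G] [BorelSpace G] in
/-- Bookkeeping: a product of two bounded observables is bounded. [folklore] -/
theorem bdd_mul {A B : LGConfig 4 G → ℝ} (hA : ∃ C, ∀ U, |A U| ≤ C) (hB : ∃ C, ∀ U, |B U| ≤ C) :
    ∃ C, ∀ U, |A U * B U| ≤ C := by
  obtain ⟨a, ha⟩ := hA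
  obtain ⟨b, hb⟩ := hB
  exact ⟨a * b, fun U => by
    rw [abs_mul]
    exact mul_le_mul (ha U) (hb U) (abs_nonneg _) ((abs_nonneg _).trans (ha U))⟩

variable {N : ℕ} (ρ : G →* Matrix (Fin N) (Fin N) ℂ)

/-- **The main identity behind the symmetry**: `⟨(A∘θ)·(B∘α_t)⟩_μ = ⟨(B∘θ)·(A∘α_t)⟩_μ` for every torus-limit state `μ` and bounded
continuous cylinder observables `A, B` — substitute `U ↦ θU` (θ-invariance, `θ∘θ = id`), rewrite `α_t ∘ θ = θ ∘ T_{t e₀}`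
(`timeShiftLG_timeReflectLG`), substitute `U ↦ T_{t e₀} U` (B-TI). [cite: SeilerLNP1982, Ch. 3] -/
theorem integral_reflect_mul_shift_comm (hρ : Continuous ρ) {β : ℝ} {μ : Measure (LGConfig 4 G)}
    (hμ : μ ∈ infiniteVolumeLimitPoints (d := 4) ρ β) {A B : LGConfig 4 G → ℝ} {SA SB : Finset (QuantumLattice.ZdEdge 4)}
    (hAS : IsCylinder A SA) (hAc : Continuous A) (hAb : ∃ C, ∀ U, |A U| ≤ C)
    (hBS : IsCylinder B SB) (hBc : Continuous B) (hBb : ∃ C, ∀ U, |B U| ≤ C) (t : ℕ) :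
    ∫ U, A (timeReflectLG U) * B (timeShiftLG (G := G) t U) ∂μ =
      ∫ U, B (timeReflectLG U) * A (timeShiftLG (G := G) t U) ∂μ := by
  -- step 1: θ-invariance applied to `Ψ(U) = A(U) · B(α_t(θU))`
  obtain ⟨⟨SΨ, hΨS⟩, hΨc, hΨb⟩ := obs_comp_timeShiftLG_timeReflectLG (G := G) hBS hBc hBb t
  have h1 : ∫ U, A (timeReflectLG U) * B (timeShiftLG (G := G) t U) ∂μ =
      ∫ U, A U * B (timeShiftLG (G := G) t (timeReflectLG U)) ∂μ := by
    have h := integral_comp_timeReflectLG_of_mem_limitPoints ρ hρ hμ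
      (F := fun U => A U * B (timeShiftLG (G := G) t (timeReflectLG U)))
      (IsCylinder.mul hAS hΨS) (hAc.mul hΨc) (bdd_mul hAb hΨb)
    simpa only [timeReflectLG_timeReflectLG] using h
  -- step 2/3: `α_t ∘ θ = θ ∘ T_{t e₀}` and B-TI applied to `Ξ(U) = A(α_t U) · B(θU)`
  obtain ⟨⟨SΞ, hΞS⟩, hΞc, hΞb⟩ := obs_comp_timeReflectLG (G := G) hBS hBc hBb
  obtain ⟨hAt, hAtc, hAtb⟩ := obs_comp_timeShiftLG (G := G) hAS hAc hAb t
  have h3 : ∫ U, A U * B (timeShiftLG (G := G) t (timeReflectLG U)) ∂μ =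
      ∫ U, A (timeShiftLG (G := G) t U) * B (timeReflectLG U) ∂μ := by
    have h := integral_comp_configShift_of_mem_limitPoints ρ hμ (Pi.single 0 (t : ℤ))
      (F := fun U => A (timeShiftLG (G := G) t U) * B (timeReflectLG U))
      (IsCylinder.mul hAt hΞS) (hAtc.mul hΞc) (bdd_mul hAtb hΞb)
    rw [← h]
    refine integral_congr_ae (ae_of_all _ fun U => ?_)
    simp only [timeShiftLG_timeReflectLG, timeShiftLG_configShift_single]
  rw [h1, h3]
  refine integral_congr_ae (ae_of_all _ fun U => ?_)
  simp only [mul_comm]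

/-- **Symmetry of the pair form** `B_t(A, B) = ⟨(A∘θ)(B∘α_t)⟩ − ⟨A∘θ⟩⟨B∘α_t⟩`: `B_t(A, B) = B_t(B, A)` for every torus-limit state and
bounded continuous cylinder observables `A, B` (θ-invariance and time-translation invariance of the limit state).
[cite: SeilerLNP1982, Ch. 3] -/
theorem pairForm_symm (hρ : Continuous ρ) {β : ℝ} {μ : Measure (LGConfig 4 G)}
    (hμ : μ ∈ infiniteVolumeLimitPoints (d := 4) ρ β) {A B : LGConfig 4 G → ℝ} {SA SB : Finset (QuantumLattice.ZdEdge 4)}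
    (hAS : IsCylinder A SA) (hAc : Continuous A) (hAb : ∃ C, ∀ U, |A U| ≤ C)
    (hBS : IsCylinder B SB) (hBc : Continuous B) (hBb : ∃ C, ∀ U, |B U| ≤ C) (t : ℕ) :
    (∫ U, A (timeReflectLG U) * B (timeShiftLG (G := G) t U) ∂μ) -
        (∫ U, A (timeReflectLG U) ∂μ) * (∫ U, B (timeShiftLG (G := G) t U) ∂μ) =
      (∫ U, B (timeReflectLG U) * A (timeShiftLG (G := G) t U) ∂μ) -
        (∫ U, B (timeReflectLG U) ∂μ) * (∫ U, A (timeShiftLG (G := G) t U) ∂μ) := by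
  rw [integral_reflect_mul_shift_comm ρ hρ hμ hAS hAc hAb hBS hBc hBb t,
    integral_comp_timeReflectLG_of_mem_limitPoints ρ hρ hμ hAS hAc hAb,
    integral_comp_timeReflectLG_of_mem_limitPoints ρ hρ hμ hBS hBc hBb,
    integral_comp_timeShiftLG_of_mem_limitPoints ρ hμ hAS hAc hAb,
    integral_comp_timeShiftLG_of_mem_limitPoints ρ hμ hBS hBc hBb, mul_comm]

/-- **Shift rule of the pair form** (B-TI only, no reflection invariance needed):
`⟨θA · α_{n+s}B⟩ − ⟨θA⟩⟨α_{n+s}B⟩ = ⟨θ(α_sA) · α_nB⟩ − ⟨θ(α_sA)⟩⟨α_nB⟩`, where `α_sA = A ∘ α_s` — translate by `+s e₀` and use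
`θ ∘ T_{s e₀} = α_s ∘ θ`, `α_{n+s} ∘ T_{s e₀} = α_n`.  With `A = B = F`, `n = s` it says `rpCorr μ F (2s) = rpCorr μ (F∘α_s) 0`.
[cite: SeilerLNP1982, Ch. 3] -/
theorem pairForm_shift {β : ℝ} {μ : Measure (LGConfig 4 G)}
    (hμ : μ ∈ infiniteVolumeLimitPoints (d := 4) ρ β) {A B : LGConfig 4 G → ℝ} {SA SB : Finset (QuantumLattice.ZdEdge 4)}
    (hAS : IsCylinder A SA) (hAc : Continuous A) (hAb : ∃ C, ∀ U, |A U| ≤ C)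
    (hBS : IsCylinder B SB) (hBc : Continuous B) (hBb : ∃ C, ∀ U, |B U| ≤ C) (n s : ℕ) :
    (∫ U, A (timeReflectLG U) * B (timeShiftLG (G := G) (n + s) U) ∂μ) -
        (∫ U, A (timeReflectLG U) ∂μ) * (∫ U, B (timeShiftLG (G := G) (n + s) U) ∂μ) =
      (∫ U, A (timeShiftLG (G := G) s (timeReflectLG U)) * B (timeShiftLG (G := G) n U) ∂μ) -
        (∫ U, A (timeShiftLG (G := G) s (timeReflectLG U)) ∂μ) * (∫ U, B (timeShiftLG (G := G) n U) ∂μ) := by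
  obtain ⟨⟨S₁, hS₁⟩, hc₁, hb₁⟩ := obs_comp_timeReflectLG (G := G) hAS hAc hAb
  obtain ⟨hBn, hBnc, hBnb⟩ := obs_comp_timeShiftLG (G := G) hBS hBc hBb (n + s)
  -- main term: B-TI at `v = +s e₀` applied to `Φ(U) = A(θU) · B(α_{n+s} U)`
  have hmain : ∫ U, A (timeShiftLG (G := G) s (timeReflectLG U)) * B (timeShiftLG (G := G) n U) ∂μ =
      ∫ U, A (timeReflectLG U) * B (timeShiftLG (G := G) (n + s) U) ∂μ := by
    have h := integral_comp_configShift_of_mem_limitPoints ρ hμ (Pi.single 0 (s : ℤ))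
      (F := fun U => A (timeReflectLG U) * B (timeShiftLG (G := G) (n + s) U))
      (IsCylinder.mul hS₁ hBn) (hc₁.mul hBnc) (bdd_mul hb₁ hBnb)
    rw [← h]
    refine integral_congr_ae (ae_of_all _ fun U => ?_)
    simp only [← timeShiftLG_timeReflectLG, timeShiftLG_add_configShift_single]
  -- first mean: B-TI applied to `A ∘ θ`
  have hmean : ∫ U, A (timeShiftLG (G := G) s (timeReflectLG U)) ∂μ = ∫ U, A (timeReflectLG U) ∂μ := by
    have h := integral_comp_configShift_of_mem_limitPoints ρ hμ (Pi.single 0 (s : ℤ))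
      (F := fun U => A (timeReflectLG U)) hS₁ hc₁ hb₁
    rw [← h]
    refine integral_congr_ae (ae_of_all _ fun U => ?_)
    simp only [← timeShiftLG_timeReflectLG]
  rw [hmain, hmean, integral_comp_timeShiftLG_of_mem_limitPoints ρ hμ hBS hBc hBb (n + s),
    integral_comp_timeShiftLG_of_mem_limitPoints ρ hμ hBS hBc hBb n]

end PairForm

/-! ### §4. The registered stub, by name and signature -/

/-- **Registered stub `stub_pairFormSymm` of crux `stmt-QuantumFields-22999` (`SteinGapBootstrap.GapGivesClusteringG`), line
«polarisation» (BC3 birth skeleton), BY NAME AND SIGNATURE**: for every compact simple `G`, faithful unitary lattice representation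
`r`, real `β`, torus-limit state `μ ∈ infiniteVolumeLimitPoints r.ρ β` (any parity) and positive-time observables `A, B`, the pair
form is symmetric: `⟨θA·α_tB⟩ − ⟨θA⟩⟨α_tB⟩ = ⟨θB·α_tA⟩ − ⟨θB⟩⟨α_tA⟩`.  (`IsCompactSimpleLieGroup G` is idle here.)
[cite: SeilerLNP1982, Ch. 3] -/
theorem stub_pairFormSymm :
    ∀ (G : Type) [Group G] [TopologicalSpace G] [IsTopologicalGroup G] [CompactSpace G], IsCompactSimpleLieGroup G →
    letI : MeasurableSpace G := borel G; haveI : BorelSpace G := ⟨rfl⟩;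
    ∀ r : LatticeRep G, ∀ β : ℝ, ∀ μ ∈ infiniteVolumeLimitPoints (d := 4) r.ρ β,
    ∀ (A B : LGConfig 4 G → ℝ), IsPosTimeObs A → IsPosTimeObs B → ∀ t : ℕ,
      (∫ U, A (timeReflectLG U) * B (timeShiftLG (G := G) t U) ∂μ) - (∫ U, A (timeReflectLG U) ∂μ) * (∫ U, B (timeShiftLG (G := G) t U) ∂μ)
        = (∫ U, B (timeReflectLG U) * A (timeShiftLG (G := G) t U) ∂μ) - (∫ U, B (timeReflectLG U) ∂μ) * (∫ U, A (timeShiftLG (G := G) t U) ∂μ) := by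
  intro G _ _ _ _ _hG
  letI : MeasurableSpace G := borel G
  haveI : BorelSpace G := ⟨rfl⟩
  intro r β μ hμ A B hA hB t
  obtain ⟨SA, hAS, -⟩ := hA.cyl
  obtain ⟨SB, hBS, -⟩ := hB.cyl
  exact pairForm_symm r.ρ r.continuous hμ hAS hA.cont hA.bdd hBS hB.cont hB.bdd t

end Summit.QuantumFields.YangMills.Theorems.SteinGapBootstrap

end
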